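import Literature.NumberTheory.LFunctions.JensenXiMomentForm
import HarnessLib

/-!
# The tilted measures `u^k Φ(u) du`: un-conditioning of the centred absolute moments

`Literature/NumberTheory/LFunctions/`. Bookkeeping step (5.5)–(5.6) of the Jensen track's tail lemma
(eng-3, LADDER-BL.md THEOREM A): the centred absolute moments
`xiAbsMoment k l ū_k = ∫₀^∞ Φ(u)u^k |u − ū_k|^l du` of the FULL measure `ν_k ∝ u^kΦ(u)du`
(`ū_k = xiMean k` its mean) are controlled by

* the centred absolute moment of the BULK `[b, ∞)` about the bulk mean `c`
  (`∫_{[b,∞)} Φu^k |u − c|^l ≤ G` — supplied, for the strongly log-concave bulk, by Brascamp–Lieb's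
  Gaussian domination, Thm 5.1 of [BrascampLieb1976], formalised elsewhere), and
* the LEFT PIECE `(0, b)` through the two integrals `∫₀^b Φu^k (D + (b − u))` and
  `∫₀^b Φu^k (D + (b − u))^l`, where `D ≥ ū_k − b ≥ 0` (one-sided tail quantities),

namely (`xiAbsMoment_mean_le_uncondition`), for every `θ ∈ (0,1)`,

  `∫₀^∞ Φu^k|u − ū|^l ≤ G/θ^{l−1} + (∫₀^b Φu^k(D + b − u))^l / ((1−θ)^{l−1} M_J^{l−1}) + ∫₀^b Φu^k (D + b − u)^l`,

`M_J = ∫_{[b,∞)} Φu^k` the bulk mass. The middle term is the mean shift `|c − ū|^l M_J` (exactly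
`M_J (c − ū) = ∫₀^b Φu^k (ū − u)`); the two-point convexity `|x+y|^l ≤ |x|^l/θ^{l−1} + |y|^l/(1−θ)^{l−1}`
replaces Minkowski's inequality (optimising `θ` recovers it). Dividing by `ū^l M_k` bounds
`|m_l(k)| = |xiCM k l|` (`abs_xiCM_le`). Theorems only; no definitions.

References: Griffin–Ono–Rolen–Zagier, PNAS 116 (2019), Thm 7 / §5.1 (`m_l(k) → 0`, made effective
by such bounds) [GORZPNAS2019]; Brascamp–Lieb, J. Funct. Anal. 22 (1976), Thm 5.1 [BrascampLieb1976].
-/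

noncomputable section

open MeasureTheory Set Filter
open scoped Topology

namespace Literature.NumberTheory.LFunctions

/-- Two-point convexity of `|·|^l`: `|x + y|^l ≤ |x|^l/θ^{l−1} + |y|^l/(1−θ)^{l−1}` for `θ ∈ (0,1)`,
`l ≥ 1`. [folklore] -/
private theorem abs_add_pow_le_div {l : ℕ} (hl : 1 ≤ l) {θ : ℝ} (hθ0 : 0 < θ) (hθ1 : θ < 1)
    (x y : ℝ) :
    |x + y| ^ l ≤ |x| ^ l / θ ^ (l - 1) + |y| ^ l / (1 - θ) ^ (l - 1) := by
  obtain ⟨m, rfl⟩ : ∃ m, l = m + 1 := ⟨l - 1, (Nat.sub_add_cancel hl).symm⟩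
  rw [Nat.add_sub_cancel]
  have hθ1' : 0 < 1 - θ := by linarith
  have hconv := (convexOn_pow (m + 1)).2 (mem_Ici.2 (div_nonneg (abs_nonneg x) hθ0.le))
    (mem_Ici.2 (div_nonneg (abs_nonneg y) hθ1'.le)) hθ0.le hθ1'.le (by ring : θ + (1 - θ) = 1)
  simp only [smul_eq_mul] at hconv
  have e1 : θ * (|x| / θ) + (1 - θ) * (|y| / (1 - θ)) = |x| + |y| := by
    field_simp
  have e2 : θ * (|x| / θ) ^ (m + 1) + (1 - θ) * (|y| / (1 - θ)) ^ (m + 1) =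
      |x| ^ (m + 1) / θ ^ m + |y| ^ (m + 1) / (1 - θ) ^ m := by
    rw [div_pow, div_pow, pow_succ θ m, pow_succ (1 - θ) m]
    field_simp
  rw [e1, e2] at hconv
  exact (pow_le_pow_left₀ (abs_nonneg _) (abs_add_le x y) _).trans hconv

/-- The bulk `[b, ∞)`, `b > 0`, has positive mass under `Φ(u)u^k du`. [folklore] -/
private theorem setIntegral_Ici_phi_pow_pos (k : ℕ) {b : ℝ} (hb : 0 < b) :
    0 < ∫ u in Ici b, deBruijnPhi u * u ^ k := by
  have hsub : Ici b ⊆ Ioi (0 : ℝ) := fun u hu => lt_of_lt_of_le hb hu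
  have hint : IntegrableOn (fun u : ℝ => deBruijnPhi u * u ^ k) (Ici b) :=
    (integrableOn_deBruijnPhi_mul_pow k).mono_set hsub
  rw [setIntegral_pos_iff_support_of_nonneg_ae
    (ae_restrict_of_forall_mem measurableSet_Ici fun u hu =>
      (mul_pos (deBruijnPhi_pos_holds u) (pow_pos (hsub hu) k)).le) hint]
  have hsub' : Ici b ⊆ (Function.support fun u : ℝ => deBruijnPhi u * u ^ k) ∩ Ici b :=
    fun u hu => ⟨(mul_pos (deBruijnPhi_pos_holds u) (pow_pos (hsub hu) k)).ne', hu⟩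
  refine lt_of_lt_of_le ?_ (measure_mono hsub')
  rw [Real.volume_Ici]; exact ENNReal.zero_lt_top

/-- Splitting an integral over `(0, ∞)` at `b > 0` into `(0, b)` and `[b, ∞)`. [folklore] -/
private theorem setIntegral_Ioi_eq_Ioo_add_Ici {f : ℝ → ℝ} {b : ℝ} (hb : 0 < b)
    (hf : IntegrableOn f (Ioi 0)) :
    ∫ u in Ioi 0, f u = (∫ u in Ioo 0 b, f u) + ∫ u in Ici b, f u := by
  have hsub : Ici b ⊆ Ioi (0 : ℝ) := fun u hu => lt_of_lt_of_le hb hu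
  have hdisj : Disjoint (Ioo (0 : ℝ) b) (Ici b) :=
    disjoint_left.2 fun u hu hu' => not_le.2 hu.2 (mem_Ici.1 hu')
  rw [← Ioo_union_Ici_eq_Ioi hb, setIntegral_union hdisj measurableSet_Ici
    (hf.mono_set Ioo_subset_Ioi_self) (hf.mono_set hsub)]

/-- **Un-conditioning of the centred absolute moments of `ν_k ∝ u^kΦ(u)du`.** Let `l ≥ 1`, `b > 0`,
`θ ∈ (0,1)`; let `c` be the mean of the bulk `[b,∞)` (`M_J c = ∫_{[b,∞)} Φu^k·u`), assume the full
mean satisfies `b ≤ ū_k ≤ b + D`, and let `G` bound the bulk centred absolute moment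
`∫_{[b,∞)} Φu^k|u − c|^l`. Then
`∫₀^∞ Φu^k|u − ū_k|^l ≤ G/θ^{l−1} + (∫₀^b Φu^k(D + b − u))^l/((1−θ)^{l−1}M_J^{l−1}) + ∫₀^b Φu^k(D + b − u)^l`.
[cite: GORZPNAS2019, Thm 7 and §5.1] -/
theorem xiAbsMoment_mean_le_uncondition (k : ℕ) {l : ℕ} (hl : 1 ≤ l) {b θ D G c : ℝ}
    (hb : 0 < b) (hθ0 : 0 < θ) (hθ1 : θ < 1)
    (hc : (∫ u in Ici b, deBruijnPhi u * u ^ k) * c = ∫ u in Ici b, deBruijnPhi u * u ^ k * u)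
    (hbū : b ≤ xiMean k) (hD : xiMean k - b ≤ D)
    (hbulk : ∫ u in Ici b, deBruijnPhi u * u ^ k * |u - c| ^ l ≤ G) :
    xiAbsMoment k l (xiMean k) ≤
      G / θ ^ (l - 1) +
      (∫ u in Ioo 0 b, deBruijnPhi u * u ^ k * (D + (b - u))) ^ l /
        ((1 - θ) ^ (l - 1) * (∫ u in Ici b, deBruijnPhi u * u ^ k) ^ (l - 1)) +
      ∫ u in Ioo 0 b, deBruijnPhi u * u ^ k * (D + (b - u)) ^ l := by
  obtain ⟨m, rfl⟩ : ∃ m, l = m + 1 := ⟨l - 1, (Nat.sub_add_cancel hl).symm⟩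
  rw [Nat.add_sub_cancel]
  have hθ1' : 0 < 1 - θ := by linarith
  have hsubJ : Ici b ⊆ Ioi (0 : ℝ) := fun u hu => lt_of_lt_of_le hb hu
  have hw0 : ∀ u ∈ Ioi (0 : ℝ), 0 ≤ deBruijnPhi u * u ^ k :=
    fun u hu => (mul_pos (deBruijnPhi_pos_holds u) (pow_pos hu k)).le
  have hM := xiMoment_pos k
  have hū := xiMean_pos k
  have hMJpos : 0 < ∫ u in Ici b, deBruijnPhi u * u ^ k := setIntegral_Ici_phi_pow_pos k hb
  have hD0 : 0 ≤ D := by linarith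
  -- integrability on `(0, ∞)` of the integrands involved
  have iw : IntegrableOn (fun u : ℝ => deBruijnPhi u * u ^ k) (Ioi 0) :=
    integrableOn_deBruijnPhi_mul_pow k
  have iwu : IntegrableOn (fun u : ℝ => deBruijnPhi u * u ^ k * u) (Ioi 0) := by
    refine (integrableOn_deBruijnPhi_mul_pow (k + 1)).congr_fun (fun u _ => ?_) measurableSet_Ioi
    simp only [pow_succ]; ring
  have iAbs : ∀ (a : ℝ) (j : ℕ),
      IntegrableOn (fun u : ℝ => deBruijnPhi u * u ^ k * |u - a| ^ j) (Ioi 0) :=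
    fun a j => integrableOn_deBruijnPhi_mul_pow_mul_abs_pow k j a
  have iSub : ∀ (a : ℝ) (j : ℕ),
      IntegrableOn (fun u : ℝ => deBruijnPhi u * u ^ k * (u - a) ^ j) (Ioi 0) :=
    fun a j => integrableOn_deBruijnPhi_mul_pow_mul_sub_pow k j a
  have iU : IntegrableOn (fun u : ℝ => deBruijnPhi u * u ^ k * (u - xiMean k)) (Ioi 0) := by
    simpa only [pow_one] using iSub (xiMean k) 1
  have iU' : IntegrableOn (fun u : ℝ => deBruijnPhi u * u ^ k * (xiMean k - u)) (Ioi 0) := by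
    have h : IntegrableOn (fun u : ℝ => -(deBruijnPhi u * u ^ k * (u - xiMean k))) (Ioi 0) := iU.neg
    refine h.congr_fun (fun u _ => ?_) measurableSet_Ioi
    ring
  have iLin : IntegrableOn (fun u : ℝ => deBruijnPhi u * u ^ k * (D + (b - u))) (Ioi 0) := by
    have h : IntegrableOn (fun u : ℝ => -(deBruijnPhi u * u ^ k * (u - (D + b)) ^ 1)) (Ioi 0) :=
      (iSub (D + b) 1).neg
    refine h.congr_fun (fun u _ => ?_) measurableSet_Ioi
    simp only [pow_one]; ring
  have iPow : IntegrableOn (fun u : ℝ => deBruijnPhi u * u ^ k * (D + (b - u)) ^ (m + 1)) (Ioi 0) := by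
    have h : IntegrableOn (fun u : ℝ => (-1) ^ (m + 1) * (deBruijnPhi u * u ^ k * (u - (D + b)) ^ (m + 1)))
        (Ioi 0) := (iSub (D + b) (m + 1)).const_mul ((-1) ^ (m + 1))
    refine h.congr_fun (fun u _ => ?_) measurableSet_Ioi
    have e : D + (b - u) = (-1) * (u - (D + b)) := by ring
    simp only [e, mul_pow]; ring
  -- (1) the first central moment vanishes
  have hfirst : ∫ u in Ioi 0, deBruijnPhi u * u ^ k * (u - xiMean k) = 0 := by
    have e : (fun u : ℝ => deBruijnPhi u * u ^ k * (u - xiMean k)) =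
        fun u => deBruijnPhi u * u ^ k * u - xiMean k * (deBruijnPhi u * u ^ k) := by
      funext u; ring
    rw [e, integral_sub iwu (iw.const_mul _), integral_const_mul]
    have h1 : ∫ u in Ioi 0, deBruijnPhi u * u ^ k * u = xiMoment (k + 1) := by
      rw [xiMoment]; refine setIntegral_congr_fun measurableSet_Ioi fun u _ => ?_
      simp only [pow_succ]; ring
    rw [h1, ← xiMoment, xiMean, div_mul_cancel₀ _ hM.ne']
    ring
  -- (2) the mean shift: `MJ (c - ū) = ∫_L Φu^k (ū - u)`, and `0 ≤ that ≤ I₁`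
  have hJ1 : ∫ u in Ici b, deBruijnPhi u * u ^ k * (u - xiMean k) =
      (∫ u in Ici b, deBruijnPhi u * u ^ k) * c -
        (∫ u in Ici b, deBruijnPhi u * u ^ k) * xiMean k := by
    have e : (fun u : ℝ => deBruijnPhi u * u ^ k * (u - xiMean k)) =
        fun u => deBruijnPhi u * u ^ k * u - xiMean k * (deBruijnPhi u * u ^ k) := by
      funext u; ring
    rw [e, integral_sub (iwu.mono_set hsubJ) ((iw.mono_set hsubJ).const_mul _), integral_const_mul,
      ← hc]
    ring
  have hsplit1 := setIntegral_Ioi_eq_Ioo_add_Ici hb iU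
  have hshift : (∫ u in Ici b, deBruijnPhi u * u ^ k) * (c - xiMean k) =
      ∫ u in Ioo 0 b, deBruijnPhi u * u ^ k * (xiMean k - u) := by
    have e2 : ∫ u in Ioo 0 b, deBruijnPhi u * u ^ k * (xiMean k - u) =
        -∫ u in Ioo 0 b, deBruijnPhi u * u ^ k * (u - xiMean k) := by
      rw [← integral_neg]; refine integral_congr_ae (ae_of_all _ fun u => ?_); ring
    rw [e2, mul_sub, ← hJ1]
    linarith
  have hI₁_nonneg_bound : 0 ≤ ∫ u in Ioo 0 b, deBruijnPhi u * u ^ k * (xiMean k - u) ∧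
      ∫ u in Ioo 0 b, deBruijnPhi u * u ^ k * (xiMean k - u) ≤
        ∫ u in Ioo 0 b, deBruijnPhi u * u ^ k * (D + (b - u)) := by
    constructor
    · refine setIntegral_nonneg measurableSet_Ioo fun u hu => ?_
      exact mul_nonneg (hw0 u hu.1) (by linarith [hu.2])
    · refine setIntegral_mono_on (iU'.mono_set Ioo_subset_Ioi_self)
        (iLin.mono_set Ioo_subset_Ioi_self) measurableSet_Ioo fun u hu => ?_
      exact mul_le_mul_of_nonneg_left (by linarith [hu.2]) (hw0 u hu.1)
  obtain ⟨hS0, hS1⟩ := hI₁_nonneg_bound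
  set MJ := ∫ u in Ici b, deBruijnPhi u * u ^ k with hMJ
  set I₁ := ∫ u in Ioo 0 b, deBruijnPhi u * u ^ k * (D + (b - u)) with hI₁
  have hI₁0 : 0 ≤ I₁ := hS0.trans hS1
  have habsΔ : |c - xiMean k| ≤ I₁ / MJ := by
    rw [le_div_iff₀ hMJpos, ← abs_of_pos hMJpos, ← abs_mul, mul_comm, hshift, abs_of_nonneg hS0]
    exact hS1
  -- (3) the bulk piece
  have hbulk' : ∫ u in Ici b, deBruijnPhi u * u ^ k * |u - xiMean k| ^ (m + 1) ≤
      G / θ ^ m + (I₁ / MJ) ^ (m + 1) * MJ / (1 - θ) ^ m := by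
    have hpt : ∀ u ∈ Ici b, deBruijnPhi u * u ^ k * |u - xiMean k| ^ (m + 1) ≤
        deBruijnPhi u * u ^ k * |u - c| ^ (m + 1) / θ ^ m +
          |c - xiMean k| ^ (m + 1) / (1 - θ) ^ m * (deBruijnPhi u * u ^ k) := by
      intro u hu
      have h := abs_add_pow_le_div hl hθ0 hθ1 (u - c) (c - xiMean k)
      rw [Nat.add_sub_cancel, show u - c + (c - xiMean k) = u - xiMean k by ring] at h
      have := mul_le_mul_of_nonneg_left h (hw0 u (hsubJ hu))
      calc deBruijnPhi u * u ^ k * |u - xiMean k| ^ (m + 1)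
          ≤ deBruijnPhi u * u ^ k * (|u - c| ^ (m + 1) / θ ^ m + |c - xiMean k| ^ (m + 1) / (1 - θ) ^ m) :=
            this
        _ = _ := by ring
    have i1 : IntegrableOn (fun u : ℝ => deBruijnPhi u * u ^ k * |u - c| ^ (m + 1) / θ ^ m) (Ici b) :=
      ((iAbs c (m + 1)).mono_set hsubJ).div_const _
    have i2 : IntegrableOn (fun u : ℝ => |c - xiMean k| ^ (m + 1) / (1 - θ) ^ m *
        (deBruijnPhi u * u ^ k)) (Ici b) := (iw.mono_set hsubJ).const_mul _
    calc ∫ u in Ici b, deBruijnPhi u * u ^ k * |u - xiMean k| ^ (m + 1)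
        ≤ ∫ u in Ici b, (deBruijnPhi u * u ^ k * |u - c| ^ (m + 1) / θ ^ m +
            |c - xiMean k| ^ (m + 1) / (1 - θ) ^ m * (deBruijnPhi u * u ^ k)) :=
          setIntegral_mono_on ((iAbs (xiMean k) (m + 1)).mono_set hsubJ) (i1.add i2)
            measurableSet_Ici hpt
      _ = (∫ u in Ici b, deBruijnPhi u * u ^ k * |u - c| ^ (m + 1)) / θ ^ m +
            |c - xiMean k| ^ (m + 1) / (1 - θ) ^ m * MJ := by
          have eq1 : ∫ u in Ici b, deBruijnPhi u * u ^ k * |u - c| ^ (m + 1) / θ ^ m =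
              (∫ u in Ici b, deBruijnPhi u * u ^ k * |u - c| ^ (m + 1)) / θ ^ m :=
            integral_div _ _
          have eq2 : ∫ u in Ici b, |c - xiMean k| ^ (m + 1) / (1 - θ) ^ m * (deBruijnPhi u * u ^ k) =
              |c - xiMean k| ^ (m + 1) / (1 - θ) ^ m * ∫ u in Ici b, deBruijnPhi u * u ^ k :=
            integral_const_mul _ _
          rw [integral_add i1 i2, eq1, eq2]
      _ ≤ G / θ ^ m + (I₁ / MJ) ^ (m + 1) / (1 - θ) ^ m * MJ := by
          have h1 : (∫ u in Ici b, deBruijnPhi u * u ^ k * |u - c| ^ (m + 1)) / θ ^ m ≤ G / θ ^ m :=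
            div_le_div_of_nonneg_right hbulk (pow_pos hθ0 m).le
          have h2 : |c - xiMean k| ^ (m + 1) / (1 - θ) ^ m * MJ ≤
              (I₁ / MJ) ^ (m + 1) / (1 - θ) ^ m * MJ := by
            apply mul_le_mul_of_nonneg_right _ hMJpos.le
            apply div_le_div_of_nonneg_right _ (pow_pos hθ1' m).le
            exact pow_le_pow_left₀ (abs_nonneg _) habsΔ _
          linarith
      _ = G / θ ^ m + (I₁ / MJ) ^ (m + 1) * MJ / (1 - θ) ^ m := by ring
  -- (4) the left piece
  have hleft : ∫ u in Ioo 0 b, deBruijnPhi u * u ^ k * |u - xiMean k| ^ (m + 1) ≤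
      ∫ u in Ioo 0 b, deBruijnPhi u * u ^ k * (D + (b - u)) ^ (m + 1) := by
    refine setIntegral_mono_on ((iAbs (xiMean k) (m + 1)).mono_set Ioo_subset_Ioi_self)
      (iPow.mono_set Ioo_subset_Ioi_self) measurableSet_Ioo fun u hu => ?_
    refine mul_le_mul_of_nonneg_left ?_ (hw0 u hu.1)
    have h1 : |u - xiMean k| = xiMean k - u := by
      rw [abs_sub_comm]; exact abs_of_nonneg (by linarith [hu.2])
    rw [h1]
    exact pow_le_pow_left₀ (by linarith [hu.2]) (by linarith [hu.2]) _
  -- (5) assemble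
  have hsplit := setIntegral_Ioi_eq_Ioo_add_Ici hb (iAbs (xiMean k) (m + 1))
  rw [xiAbsMoment, hsplit]
  have hmid : (I₁ / MJ) ^ (m + 1) * MJ / (1 - θ) ^ m = I₁ ^ (m + 1) / ((1 - θ) ^ m * MJ ^ m) := by
    rw [div_pow, pow_succ MJ m]
    field_simp
  rw [hmid] at hbulk'
  linarith

/-- `δ₁(n)·√(2n+1) = 1` (`δ₁(n) = (2n+1)^{−1/2}`). [cite: GORZPNAS2019, §5.1 eq. (18)] -/
theorem deltaOne_mul_sqrt (n : ℕ) : deltaOne n * Real.sqrt (2 * n + 1) = 1 := by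
  have h2 : (0 : ℝ) < 2 * n + 1 := by positivity
  have hy : GORZAsymp.yseq n / 2 = 1 / (2 * n + 1) := by
    rw [GORZAsymp.yseq]; field_simp
  rw [deltaOne, hy, ← Real.sqrt_mul (by positivity), one_div, inv_mul_cancel₀ h2.ne', Real.sqrt_one]

/-- **From the un-normalised to the normalised moments**: `|μ_l(n)| ≤ (2n+1)^{l/2}·∫₀^∞Φu^{2n}|u − ū|^l / (ū^l M_{2n})`
(`μ_l(n) = xiMu n l = m_l(2n)/δ₁(n)^l`, `ū = xiMean (2n)`; from `abs_xiCM_le`).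
[cite: GORZPNAS2019, Thm 7 and §5.1] -/
theorem abs_xiMu_le_xiAbsMoment (n l : ℕ) :
    |xiMu n l| ≤ Real.sqrt (2 * n + 1) ^ l * xiAbsMoment (2 * n) l (xiMean (2 * n)) /
      (xiMean (2 * n) ^ l * xiMoment (2 * n)) := by
  have hδ := pow_pos (deltaOne_pos n) l
  have h := abs_xiCM_le (2 * n) l
  rw [xiMu, abs_div, abs_of_pos hδ, div_le_iff₀ hδ]
  have e : Real.sqrt (2 * n + 1) ^ l * xiAbsMoment (2 * n) l (xiMean (2 * n)) /
      (xiMean (2 * n) ^ l * xiMoment (2 * n)) * deltaOne n ^ l =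
      xiAbsMoment (2 * n) l (xiMean (2 * n)) / (xiMean (2 * n) ^ l * xiMoment (2 * n)) *
        (deltaOne n * Real.sqrt (2 * n + 1)) ^ l := by
    rw [mul_pow]; ring
  rw [e, deltaOne_mul_sqrt, one_pow, mul_one]
  exact h

end Literature.NumberTheory.LFunctions
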